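import Literature.NumberTheory.EllipticCurves.IwasawaAlgebraGenericTwistFiniteProofs
import Literature.NumberTheory.EllipticCurves.IwasawaEulerCharDualityProofs
import Literature.NumberTheory.IwasawaTheory.Greenberg2006.CofiniteGenerationCriterion
import HarnessLib

/-!
# Crux 4 `BSDpOnCellC` (stmt-BirchSwinnertonDyer-19034), line `telescope`, leaf N3′ `stub_memberControlMod` — the MEMBER inertia defects
# `A₂^{I_w}/(X − x_k)·A₂^{I_w}` are finite for ALL BUT FINITELY MANY fibres, for ANY cofinitely generated `A₂` and ANY group action:
# Greenberg's generic-twist finiteness read on the discrete side (helper, `--supports stmt-BirchSwinnertonDyer-19034 --as helper`; closes nothing)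

Cell `bsd-eis`, width seat `bsd-line-x2-p2` (prover g21, 2026-08-30; D-0154 KEY row 5). THEOREMS ONLY: no definition, no named fact,
no `sorry`, no instance, no notation. The kernel fact behind the seat's planning observation (STATUS l.6545, memo #46 §4): the per-member
local finiteness that N3′'s (ctrl_k) needs at an inertia index — (fin_{w,k}) «`A₂^{I_w}/(X − C x_k)·A₂^{I_w}` finite» — holds for all but
finitely many `k` WITHOUT any fibre condition, unramifiedness or newform input, because for a finitely generated `Λ = ℤ_p⟦X⟧`-module `T`
the torsion `T[X − C c]` is finite for all but finitely many `c ∈ 𝔪_{ℤ_p}` (tree: Greenberg LNM 1716 p. 117,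
`IwasawaAlgebraGenericTwistFiniteProofs.finite_setOf_not_finite_torsionBy_X_sub_C`) and `(M/θM)^∨ ↪ M^∨[θ]`:

* §1 `finite_quotSMulTop_of_finite_torsionBy_characterModule` — `M^∨[θ]` finite ⇒ `M/θ·M` finite (dual of the quotient map is injective
  with image in the `θ`-torsion; `PontryaginCard.finite_of_finite_characterModule`).
* §2 **`finite_setOf_not_finite_quotSMulTop`** — `A` cofinitely generated over `Λ`, `M ≤ A` ANY submodule:
  `{c ∈ 𝔪 | M/(X − C c)·M is infinite}` is finite.
* §3 **`finite_setOf_not_finite_quotSMulTop_fibre`** — indexed form: `x : ℕ → ℤ_p` with `‖x k‖ < 1`, injective on `𝒦`: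
  `{k ∈ 𝒦 | M/(X − C x_k)·M is infinite}` is finite; **`finite_setOf_not_finite_inertiaDefect`** — `M = A^G` the invariants of any family
  of `Λ`-linear endomorphisms (e.g. `ρ₂(I_w)`): the member inertia defects are finite for all but finitely many `k ∈ 𝒦`.

CONSEQUENCE for the registry (planning, LEAD's act): if the member clauses of K2-M♭ / N3′ are typed «for all `k` outside a finite set»
(the interpolation `carrierAlgW_of_divInt` discards finitely many fibres anyway), the inertia-side local input of (ctrl_k) is THIS theorem;
as typed (∀ k) it needs newform-conductor rigidity of every member at `ℓ ∣ N/p` (memo #46 §4). Nothing about any curve is asserted.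

HONEST FRAMING: module theory + Pontryagin duality; no registered stub, crux or summit statement is proved by this file; closes: none.

References: [GreenbergLNM1716] §4 p. 117 ("`ker(X → X)` finite for all but finitely many `s`"), pp. 123–125; [Greenberg2006] §3 A;
[Washington1997] §13.2.
-/

noncomputable section

-- D-0017: single-problem summit, the namespace repeats the problem name by design.
set_option linter.dupNamespace false
set_option autoImplicit false

open Literature.NumberTheory.EllipticCurves Literature.NumberTheory.EllipticCurves.IwasawaAlgebra
open Literature.NumberTheory.IwasawaTheory Literature.NumberTheory.IwasawaTheory.Greenberg2006
open scoped Pointwise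

namespace Summit.BirchSwinnertonDyer.BirchSwinnertonDyer.Theorems.TelescopeK2InertiaDefectGenericFibre

variable {p : ℕ} [Fact p.Prime]

/-! ## §1 `M^∨[θ]` finite ⇒ `M/θ·M` finite -/

/-- **`M^∨[θ]` finite ⇒ `M/θ·M` finite**: the dual of `M ↠ M/θM` embeds `(M/θM)^∨` into `M^∨[θ]`, and a group with finitely many
characters is finite. [cite: Greenberg2006, §2 A (p. 348 L4–6: kernel/cokernel duality)] -/
theorem finite_quotSMulTop_of_finite_torsionBy_characterModule {Λ : Type*} [CommRing Λ] {M : Type*} [AddCommGroup M] [Module Λ M]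
    (θ : Λ) [hfin : Finite (Submodule.torsionBy Λ (CharacterModule M) θ)] : Finite (QuotSMulTop θ M) := by
  classical
  let j : CharacterModule (QuotSMulTop θ M) →ₗ[Λ] CharacterModule M := CharacterModule.dual (θ • (⊤ : Submodule Λ M)).mkQ
  have hj : Function.Injective j := CharacterModule.dual_injective_of_surjective _ (Submodule.mkQ_surjective _)
  have hjmem : ∀ χ : CharacterModule (QuotSMulTop θ M), j χ ∈ Submodule.torsionBy Λ (CharacterModule M) θ := by
    intro χ
    rw [Submodule.mem_torsionBy_iff]
    refine CharacterModule.ext _ fun m => ?_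
    rw [CharacterModule.smul_apply]
    change χ ((θ • (⊤ : Submodule Λ M)).mkQ (θ • m)) = 0
    have h0 : (θ • (⊤ : Submodule Λ M)).mkQ (θ • m) = 0 := by
      rw [Submodule.mkQ_apply, Submodule.Quotient.mk_eq_zero]
      exact Submodule.smul_mem_pointwise_smul m θ ⊤ Submodule.mem_top
    rw [h0, map_zero]
  haveI : Finite (CharacterModule (QuotSMulTop θ M)) :=
    Finite.of_injective (fun χ => (⟨j χ, hjmem χ⟩ : Submodule.torsionBy Λ (CharacterModule M) θ))
      fun x y hxy => hj (congrArg Subtype.val hxy)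
  exact PontryaginCard.finite_of_finite_characterModule _

/-! ## §2 Generic finiteness of `M/θ_c·M` -/

/-- **`M/(X − C c)·M` is finite for all but finitely many `c ∈ 𝔪_{ℤ_p}`**, for ANY submodule `M` of a cofinitely generated discrete
`ℤ_p⟦X⟧`-module `A` (Greenberg's generic-twist finiteness on the finitely generated dual `M^∨`, then §1).
[cite: GreenbergLNM1716, §4 p. 117] [cite: Greenberg2006, §3 A (p. 358 L35–36: submodules of cofinitely generated modules)] -/
theorem finite_setOf_not_finite_quotSMulTop {A : Type} [AddCommGroup A] [Module (IwasawaAlgebra p) A]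
    (hA : IsCofinitelyGenerated (IwasawaAlgebra p) A) (M : Submodule (IwasawaAlgebra p) A) :
    {c : ℤ_[p] | c ∈ IsLocalRing.maximalIdeal ℤ_[p] ∧
      ¬ Finite (QuotSMulTop (PowerSeries.X - PowerSeries.C c : IwasawaAlgebra p) M)}.Finite := by
  haveI : Module.Finite (IwasawaAlgebra p) (CharacterModule M) :=
    isCofinitelyGenerated_iff_module_finite_characterModule.1 (hA.submodule M)
  refine (finite_setOf_not_finite_torsionBy_X_sub_C p (M := CharacterModule M)).subset ?_
  rintro c ⟨hc, hinf⟩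
  refine ⟨hc, fun hfin => hinf ?_⟩
  haveI := hfin
  exact finite_quotSMulTop_of_finite_torsionBy_characterModule _

/-! ## §3 Indexed form: all but finitely many member fibres -/

/-- **All but finitely many MEMBER fibres have finite defect**: for `x : ℕ → ℤ_p` with `‖x k‖ < 1`, injective on `𝒦`, and any submodule `M`
of a cofinitely generated `A`, the set `{k ∈ 𝒦 | M/(X − C x_k)·M infinite}` is finite. [cite: GreenbergLNM1716, §4 p. 117]
[cite: Greenberg2006, §3 A] -/
theorem finite_setOf_not_finite_quotSMulTop_fibre {A : Type} [AddCommGroup A] [Module (IwasawaAlgebra p) A]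
    (hA : IsCofinitelyGenerated (IwasawaAlgebra p) A) (M : Submodule (IwasawaAlgebra p) A)
    (x : ℕ → ℤ_[p]) (hx : ∀ k, ‖x k‖ < 1) (𝒦 : Set ℕ) (hinj : Set.InjOn x 𝒦) :
    {k : ℕ | k ∈ 𝒦 ∧ ¬ Finite (QuotSMulTop (PowerSeries.X - PowerSeries.C (x k) : IwasawaAlgebra p) M)}.Finite := by
  have hfin := finite_setOf_not_finite_quotSMulTop hA M
  have himage : x '' {k : ℕ | k ∈ 𝒦 ∧ ¬ Finite (QuotSMulTop (PowerSeries.X - PowerSeries.C (x k) : IwasawaAlgebra p) M)} ⊆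
      {c : ℤ_[p] | c ∈ IsLocalRing.maximalIdeal ℤ_[p] ∧
        ¬ Finite (QuotSMulTop (PowerSeries.X - PowerSeries.C c : IwasawaAlgebra p) M)} := by
    rintro _ ⟨k, ⟨-, hk⟩, rfl⟩
    exact ⟨PadicInt.mem_nonunits.2 (hx k), hk⟩
  exact Set.Finite.of_finite_image (hfin.subset himage) (hinj.mono fun k hk => hk.1)

/-- **The member inertia defects (fin_{w,k}) hold for all but finitely many `k`, unconditionally.** For `ρ₂`-type data: `A₂` a cofinitely
generated discrete `ℤ_p⟦X⟧`-module, any family `g_i` of `ℤ_p⟦X⟧`-linear endomorphisms (e.g. `ρ₂(h)`, `h ∈ I_w`) with invariants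
`A₂^G = {a | ∀ i, g_i a = a}`, and member points `x_k` (`‖x k‖ < 1`, injective on `𝒦`): for all but finitely many `k ∈ 𝒦` the quotient
`A₂^G/(X − C x_k)·A₂^G` is FINITE. No fibre condition, no unramifiedness, no newform input. [cite: GreenbergLNM1716, §4 p. 117]
[cite: Greenberg2006, §3 A] -/
theorem finite_setOf_not_finite_inertiaDefect {A : Type} [AddCommGroup A] [Module (IwasawaAlgebra p) A]
    (hA : IsCofinitelyGenerated (IwasawaAlgebra p) A) {ι : Type*} (g : ι → (A →ₗ[IwasawaAlgebra p] A))
    (x : ℕ → ℤ_[p]) (hx : ∀ k, ‖x k‖ < 1) (𝒦 : Set ℕ) (hinj : Set.InjOn x 𝒦) :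
    {k : ℕ | k ∈ 𝒦 ∧ ¬ Finite (QuotSMulTop (PowerSeries.X - PowerSeries.C (x k) : IwasawaAlgebra p)
      (↥(⨅ i, LinearMap.ker (g i - LinearMap.id) : Submodule (IwasawaAlgebra p) A)))}.Finite :=
  finite_setOf_not_finite_quotSMulTop_fibre hA _ x hx 𝒦 hinj

/-- The invariants of a family of endomorphisms as the infimum of kernels: membership. [folklore] -/
theorem mem_iInf_ker_sub_id_iff {R : Type*} [CommRing R] {A : Type*} [AddCommGroup A] [Module R A] {ι : Type*}
    (g : ι → (A →ₗ[R] A)) (a : A) :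
    a ∈ (⨅ i, LinearMap.ker (g i - LinearMap.id)) ↔ ∀ i, g i a = a := by
  simp only [Submodule.mem_iInf, LinearMap.mem_ker, LinearMap.sub_apply, LinearMap.id_apply, sub_eq_zero]

end Summit.BirchSwinnertonDyer.BirchSwinnertonDyer.Theorems.TelescopeK2InertiaDefectGenericFibre

end
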